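import Literature.AlgebraicGeometry.AbelianSchemes.IdealTorsionStableSubgroupsTransport
import Literature.AlgebraicGeometry.AbelianSchemes.AbelianSchemeFibreAlongIntegralPoint
import HarnessLib

/-!
# Dock transport: a realisation `G′ ↪ A′` of the `𝔭`-torsion with its kernel clause moves along any equivariant isomorphism
# `A′ ≅ A″`, in particular between the two presentations of a fibre along an integral point ([SerreTate1968] §1; [GortzWedhorn2020] (4.7))

Topic `Literature/AlgebraicGeometry/AbelianSchemes`; namespace `Literature.AlgebraicGeometry.AbelianSchemes.AbelianSchemeOver.IdealTorsion` (sequel of ★ (GP)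
`IdealTorsionStableSubgroupsTransport` ED. 2 and ★ (d5) `AbelianSchemeFibreAlongIntegralPoint`).  THEOREMS ONLY (no definition, no instance, no notation, no named fact,
no `sorry`).  Cell `hodgecm-mathlib` (D-0151), programme P6 «MOD» (crux hLiu418 = stmt-HodgeConjecture-24832, `--supports`, count-neutral): organ **(DT) «DOCK
TRANSPORT PACKAGE»** (LA2-plan (g0) DEAL BY NAME 2026-09-02T03:21:07Z → LA1-p04 (g0); consumers LA2-p04 (g0) LS-leaflet §2 `natCard_lineOf_eq_succ` DOWN→UP `hcard`,
LA2-p02 (g0) (O1-S) special-side seam, LA2-p03 (g0) (R9) `_of_rank` docks).  A «dock» on an abelian scheme `A′` with an `𝒪`-action is the `DockData` row package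
`(G′, ι′ : G′ ⟶ A′, [Mono ι′], [IsMonHom ι′], hker′ : (∃ s, s ≫ ι′ = t) ↔ ∀ a ∈ 𝔭, t ≫ ι′(a) = 1, hrk′ : dim Γ(G′) = r)` realising the `𝔭`-torsion `A′[𝔭]`.
§1 (ANY base, ∃-FREE): along an isomorphism `φ : A′ ≅ A″` whose `hom` is a homomorphism intertwining the actions, the SAME `G′` with `ι″ := ι′ ≫ φ.hom` (the
LITERAL composite — no new definition) is a dock on `A″`: `dockTransport_mono`, `isMonHom_dockTransport_ι`, `dockTransport_ker` (★ (GP) ED. 2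
`forall_exists_comp_iff_of_iso`), `dockTransport_ker'` (the D-line `hkerG₀` orientation), `dockTransport_action` (a dock action `β′` intertwining `ι′(c)` still
intertwines), and `hrk″ = hrk′` VERBATIM (the object `G′` is unchanged); bundle `dockTransport`.  §2 (INSTANTIATION at a fibre along an integral point, NO
moduli tower): for an abelian scheme `𝒜 → T` with action `ρ`, morphisms `j : U → T`, `x̃ : V → T` and field-valued points `y` of `U`, `u` of `V` over the same
point (`h : y ≫ j = u ≫ x̃` — a BINDER), ★ (d5) `exists_iso_fibre_baseChange_of_comp_eq` yields an isomorphism of the two presentations `(𝒜 ×_T U) ×_U y ≅ (𝒜 ×_T V) ×_V u`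
which is a homomorphism and intertwines `((ρ ×_T U) ×_U y).i a` with `((ρ ×_T V) ×_V u).i a` (`exists_equivariant_iso_baseChange_baseChange_of_comp_eq`; the
naturality clause of (d5) at `f := ρ.i a`, read through ★ `fibreHom_hom_hom_hom` and ★ `RingAction.baseChange_i`, both `rfl`); hence a dock given on
`(𝒜 ×_T U) ×_U y` (e.g. the D-line dock at `x̄` on `(univ ×_𝓨 𝓨_s) ×_{𝓨_s} x̄`) transports to `(𝒜 ×_T V) ×_V u` (e.g. `(univ ×_𝓨 Spec R) ×_R Spec κ̄`,
`u = Spec (algebraMap R κ̄)`) — `exists_dockTransport_of_comp_eq`.  §3 (ASSEMBLY with ★ (GF)∕(L-q-sub)∕(GP)): over a LOCAL `R` with `x̃ : Spec R → T`, a dock of rank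
`q²` on ANY presentation of the special fibre and ANY presentation of the geometric generic fibre (two point equations through `x̃`), the `𝔭`-torsion points
upstairs number `q²` and the `LineOf`-shaped carriers number **`q + 1`** — `natCard_stableSubgroups_eq_succ_of_dock_of_comp_eq` (= LS-leaflet §2
`natCard_lineOf_eq_succ` with the D-line tokens abstracted: feed `j₁ := ι_s`, `x₁ := x̄.left`, `j₂ := ι_η`, `x₂ := (ℓ_e y).left`, `x̃ := extendPoint …`, the two ★ (d5) §2
point equalities, the ★ Serre presentation of `𝔭_{c•w}`, the dock rows and `I.hfDeg`).  HC_CM is proved only modulo the printed citations until rung 0 closes;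
this file is generic and changes no count.

THE PRINT.  [SerreTate1968] §1 «the reduction map»: reduction of points = reduction of tuples along the valuation ring of the point; [GortzWedhorn2020]
Section (4.7) (pp. 107–108), (4.15) (p. 116), Definition 4.45 (2) (p. 117): base change is transitive up to canonical isomorphism, points and kernels
transform accordingly; [Tate1997FiniteFlatGroupSchemes] (3.7): orders and stable subgroups of a finite flat∕étale layer are invariants of its isomorphism class.

## Contents
* §1 `dockTransport_mono`, `isMonHom_dockTransport_ι`, **`dockTransport_ker`**, `dockTransport_ker'`, `dockTransport_action`, **`dockTransport`** (bundle).
* §2 **`exists_equivariant_iso_baseChange_baseChange_of_comp_eq`** (`∃ φ : ((𝒜.baseChange j).baseChange y).X ≅ ((𝒜.baseChange x̃).baseChange u).X`, `IsMonHom φ.hom ∧`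
  intertwining), **`exists_dockTransport_of_comp_eq`** (a dock on the first presentation gives a dock on the second: `∃ ι″, Mono ι″ ∧ IsMonHom ι″ ∧ clause`).
* §3 **`natCard_idealTorsion_algPoints_eq_finrank_of_dock_of_comp_eq`** (`#{P | 𝔭P = 1} = dim_L Γ(G′)` at any presentation of the geometric generic fibre from a
  dock on any presentation of the special fibre), **`natCard_stableSubgroups_eq_succ_of_dock_of_comp_eq`** (`= q + 1` lines), `exists_stableSubgroup_ne_of_dock_of_comp_eq`.

## References
* [SerreTate1968] J.-P. Serre, J. Tate, *Good reduction of abelian varieties*, Ann. of Math. 88 (1968), §1.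
* [GortzWedhorn2020] U. Görtz, T. Wedhorn, *Algebraic Geometry I*, 2nd ed. (2020), Section (4.7) (pp. 107–108), Section (4.15) (p. 116), Definition 4.45 (2) (p. 117).
* [Tate1997FiniteFlatGroupSchemes] J. Tate, *Finite flat group schemes*, in: Modular Forms and Fermat's Last Theorem (1997), (3.7).
* [MumfordFogartyKirwan1994] D. Mumford, J. Fogarty, F. Kirwan, *GIT*, 3rd ed. (1994), Ch. 7 §2 Definition 7.2 (p. 129).
-/

set_option autoImplicit false

-- Mathlib's `Over`/`Scheme` APIs are stated across semireducible wrappers (`(A.baseChange g).X` vs `(Over.pullback g).obj A.X`, `fibre`∕`toAffine`∕`toAbelianVariety`).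
set_option backward.isDefEq.respectTransparency false

noncomputable section

universe u

open CategoryTheory CategoryTheory.Limits AlgebraicGeometry MonoidalCategory CartesianMonoidalCategory
open scoped MonObj CategoryTheory.Obj
open Literature.AlgebraicGeometry.GroupSchemes Literature.AlgebraicGeometry.GroupSchemes.GroupSchemeKernel
open Literature.AlgebraicGeometry.GroupSchemes.AffineGroupScheme (Alg)
open Literature.AlgebraicGeometry.Motives (SchemeOver specOver AlgPoints AbelianVariety)

namespace Literature.AlgebraicGeometry.AbelianSchemes

namespace AbelianSchemeOver

namespace IdealTorsion

/-! ## §1 Dock transport along an equivariant isomorphism (any base, ∃-free: `ι″` is the literal `ι′ ≫ φ.hom`) -/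

section Dock

variable {S : Scheme.{u}} {A' A'' : AbelianSchemeOver S} {O : Type*} [CommRing O] (act' : A'.RingAction O) (act'' : A''.RingAction O)
  (φ : A'.X ≅ A''.X) [IsMonHom φ.hom] (hφ : ∀ a, act'.i a ≫ φ.hom = φ.hom ≫ act''.i a) {G' : Over S} (ι' : G' ⟶ A'.X)

omit [IsMonHom φ.hom] in
/-- `ι″ := ι′ ≫ φ.hom` is a monomorphism (the dock row `hι₀G.2` ⇒ `Mono`, transported). [cite: GortzWedhorn2020, Section (4.15) (p. 116)] -/
theorem dockTransport_mono [Mono ι'] : Mono (ι' ≫ φ.hom) := mono_comp _ _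

/-- `ι″ := ι′ ≫ φ.hom` is a homomorphism when `ι′` is (the dock row `hι₀G.1`, transported). [cite: GortzWedhorn2020, Section (4.15) (p. 116)] -/
theorem isMonHom_dockTransport_ι [GrpObj G'] [IsMonHom ι'] : IsMonHom (ι' ≫ φ.hom) := inferInstance

include hφ in
/-- **THE KERNEL CLAUSE OF THE TRANSPORTED DOCK** (★ (S-c) orientation): `(∃ s, s ≫ ι″ = t) ↔ ∀ a ∈ 𝔭, t ≫ ι″(a) = 1` on every `T`-point `t` of `A″`, from the clause of
`ι′` for `act′` (★ (GP) ED. 2 `forall_exists_comp_iff_of_iso`). [cite: GortzWedhorn2020, Definition 4.45 (2), p. 117] [cite: Tate1997FiniteFlatGroupSchemes, (3.7)] -/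
theorem dockTransport_ker {𝔞 : Ideal O}
    (hker' : ∀ ⦃W : Over S⦄ (t : W ⟶ A'.X), (∃ s : W ⟶ G', s ≫ ι' = t) ↔ ∀ a ∈ 𝔞, t ≫ act'.i a = 1)
    ⦃W : Over S⦄ (t : W ⟶ A''.X) : (∃ s : W ⟶ G', s ≫ (ι' ≫ φ.hom) = t) ↔ ∀ a ∈ 𝔞, t ≫ act''.i a = 1 :=
  forall_exists_comp_iff_of_iso act' act'' φ hφ ι' hker' t

include hφ in
/-- The same in the D-line dock orientation (`hkerG₀ : (∀ r ∈ w, t ≫ act.i r = 1) ↔ ∃ s, s ≫ ι₀G = t`): input and output with the torsion condition on the left.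
[cite: GortzWedhorn2020, Definition 4.45 (2), p. 117] -/
theorem dockTransport_ker' {𝔞 : Ideal O}
    (hker' : ∀ ⦃W : Over S⦄ (t : W ⟶ A'.X), (∀ a ∈ 𝔞, t ≫ act'.i a = 1) ↔ ∃ s : W ⟶ G', s ≫ ι' = t)
    ⦃W : Over S⦄ (t : W ⟶ A''.X) : (∀ a ∈ 𝔞, t ≫ act''.i a = 1) ↔ ∃ s : W ⟶ G', s ≫ (ι' ≫ φ.hom) = t :=
  (forall_exists_comp_iff_of_iso act' act'' φ hφ ι' (fun _ t => (hker' t).symm) t).symm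

include hφ in
omit [IsMonHom φ.hom] in
/-- **A DOCK ACTION STILL INTERTWINES**: if `β′ c ≫ ι′ = ι′ ≫ ι′(c)` (the dock row `hβ₀G`) then `β′ c ≫ ι″ = ι″ ≫ ι″(c)` for `ι″ := ι′ ≫ φ.hom` — the `hcomm` input of ★
(UP-ADM) `exists_equiv_subgroup_of_mono` on the transported dock. [cite: GortzWedhorn2020, Section (4.7) (pp. 107–108)] -/
theorem dockTransport_action (β' : O → (G' ⟶ G')) (hβ' : ∀ c, β' c ≫ ι' = ι' ≫ act'.i c) (c : O) :
    β' c ≫ (ι' ≫ φ.hom) = (ι' ≫ φ.hom) ≫ act''.i c := by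
  rw [← Category.assoc, hβ', Category.assoc, hφ, Category.assoc]

include hφ in
/-- **THE DOCK TRANSPORT BUNDLE**: `(G′, ι″ := ι′ ≫ φ.hom)` is a dock on `A″` — mono, homomorphism, kernel-of-`𝔭` clause — whenever `(G′, ι′)` is one on `A′`; the
rank row `hrk′ : dim Γ(G′) = r` is used VERBATIM (same object `G′`). [cite: Tate1997FiniteFlatGroupSchemes, (3.7)] [cite: GortzWedhorn2020, Definition 4.45 (2), p. 117] -/
theorem dockTransport [GrpObj G'] [Mono ι'] [IsMonHom ι'] {𝔞 : Ideal O}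
    (hker' : ∀ ⦃W : Over S⦄ (t : W ⟶ A'.X), (∃ s : W ⟶ G', s ≫ ι' = t) ↔ ∀ a ∈ 𝔞, t ≫ act'.i a = 1) :
    Mono (ι' ≫ φ.hom) ∧ IsMonHom (ι' ≫ φ.hom) ∧
      ∀ ⦃W : Over S⦄ (t : W ⟶ A''.X), (∃ s : W ⟶ G', s ≫ (ι' ≫ φ.hom) = t) ↔ ∀ a ∈ 𝔞, t ≫ act''.i a = 1 :=
  ⟨dockTransport_mono φ ι', isMonHom_dockTransport_ι φ ι', dockTransport_ker act' act'' φ hφ ι' hker'⟩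

end Dock

/-! ## §2 Instantiation: the two presentations of a fibre along an integral point -/

section Along

variable {T U V : Scheme.{u}} (j : U ⟶ T) (xt : V ⟶ T) {L : Type u} [Field L] {y : Spec (.of L) ⟶ U} {u : Spec (.of L) ⟶ V}
  (𝒜 : AbelianSchemeOver T) {O : Type*} [CommRing O] (ρ : 𝒜.RingAction O)

/-- **THE TWO PRESENTATIONS OF A FIBRE ARE EQUIVARIANTLY ISOMORPHIC**: for `h : y ≫ j = u ≫ x̃`, the abelian schemes `(𝒜 ×_T U) ×_U y` and `(𝒜 ×_T V) ×_V u` over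
`Spec L` are isomorphic by an isomorphism whose `hom` is a HOMOMORPHISM and which INTERTWINES the base-changed actions `((ρ ×_T U) ×_U y).i a`, `((ρ ×_T V) ×_V u).i a`
(★ (d5) `exists_iso_fibre_baseChange_of_comp_eq`, its naturality clause at `f := ρ.i a` read through ★ `fibreHom_hom_hom_hom` and ★ `RingAction.baseChange_i` — both
`rfl`). [cite: SerreTate1968, §1] [cite: GortzWedhorn2020, Section (4.7) (pp. 107–108) and Section (4.15) (p. 116)] [cite: MumfordFogartyKirwan1994, Ch. 7 §2 Definition 7.2 (p. 129)] -/
theorem exists_equivariant_iso_baseChange_baseChange_of_comp_eq (h : y ≫ j = u ≫ xt) :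
    ∃ φ : ((𝒜.baseChange j).baseChange y).X ≅ ((𝒜.baseChange xt).baseChange u).X,
      IsMonHom φ.hom ∧ ∀ a, ((ρ.baseChange j).baseChange y).i a ≫ φ.hom = φ.hom ≫ ((ρ.baseChange xt).baseChange u).i a := by
  obtain ⟨e, -, he⟩ := exists_iso_fibre_baseChange_of_comp_eq j xt h
  have h1 : (e 𝒜).hom.hom.hom.hom ≫ (e 𝒜).inv.hom.hom.hom = 𝟙 _ := congrArg (fun ψ => ψ.hom.hom.hom) (e 𝒜).hom_inv_id
  have h2 : (e 𝒜).inv.hom.hom.hom ≫ (e 𝒜).hom.hom.hom.hom = 𝟙 _ := congrArg (fun ψ => ψ.hom.hom.hom) (e 𝒜).inv_hom_id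
  refine ⟨⟨(e 𝒜).hom.hom.hom.hom, (e 𝒜).inv.hom.hom.hom, h1, h2⟩, inferInstance, fun a => ?_⟩
  haveI := ρ.isMonHom a
  exact congrArg (fun ψ => ψ.hom.hom.hom) (he 𝒜 𝒜 (ρ.i a))

/-- **DOCK TRANSPORT BETWEEN THE TWO PRESENTATIONS**: a dock `(G′, ι′, hker′)` on `(𝒜 ×_T U) ×_U y` (e.g. the D-line dock `(G₀, ι₀G, hkerG₀)` at `x̄`, given on the
special-fibre family `univ ×_𝓨 𝓨_s`) yields a dock `(G′, ι″, hker″)` on `(𝒜 ×_T V) ×_V u` (e.g. on `(univ ×_𝓨 Spec R) ×_R Spec κ̄`, `u = Spec (algebraMap R κ̄)`, `V = Spec R`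
an integral point `x̃` with `h : x̄ ≫ ι_s = u ≫ x̃` — ★ (d5) §2 `left_geomReductionMap_comp_fst`) with the SAME `G′`, hence the same rank.
[cite: SerreTate1968, §1] [cite: GortzWedhorn2020, Definition 4.45 (2), p. 117] [cite: Tate1997FiniteFlatGroupSchemes, (3.7)] -/
theorem exists_dockTransport_of_comp_eq (h : y ≫ j = u ≫ xt) {𝔞 : Ideal O} {G' : Over (Spec (.of L))} [GrpObj G']
    (ι' : G' ⟶ ((𝒜.baseChange j).baseChange y).X) [Mono ι'] [IsMonHom ι']
    (hker' : ∀ ⦃W : Over (Spec (.of L))⦄ (t : W ⟶ ((𝒜.baseChange j).baseChange y).X),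
      (∃ s : W ⟶ G', s ≫ ι' = t) ↔ ∀ a ∈ 𝔞, t ≫ ((ρ.baseChange j).baseChange y).i a = 1) :
    ∃ ι'' : G' ⟶ ((𝒜.baseChange xt).baseChange u).X, Mono ι'' ∧ IsMonHom ι'' ∧
      ∀ ⦃W : Over (Spec (.of L))⦄ (t : W ⟶ ((𝒜.baseChange xt).baseChange u).X),
        (∃ s : W ⟶ G', s ≫ ι'' = t) ↔ ∀ a ∈ 𝔞, t ≫ ((ρ.baseChange xt).baseChange u).i a = 1 := by
  obtain ⟨φ, hφm, hφ⟩ := exists_equivariant_iso_baseChange_baseChange_of_comp_eq j xt 𝒜 ρ h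
  haveI := hφm
  exact ⟨ι' ≫ φ.hom, dockTransport ((ρ.baseChange j).baseChange y) ((ρ.baseChange xt).baseChange u) φ hφ ι' hker'⟩

end Along

/-! ## §3 Assembly over a local base: `q²` torsion points and `q + 1` lines at ANY presentation, from a dock on ANY presentation of the special fibre -/

section Assembly

variable {R : Type u} [CommRing R] {T U₁ U₂ : Scheme.{u}} (𝒜 : AbelianSchemeOver T) {O : Type*} [CommRing O] (ρ : 𝒜.RingAction O)
  [IsCommMonObj 𝒜.X] (xt : Spec (.of R) ⟶ T)
  {m : ℕ} (E' : Matrix (Fin m) (Fin m) O) (hE' : E' * E' = E') (P : Matrix (Fin m) (Fin 1) O) (Q : Matrix (Fin 1) (Fin m) O) {N : ℕ}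

include hE' in
/-- **`#{P | 𝔭P = 1} = dim_L Γ(G′)` AT ANY PRESENTATION, FROM A DOCK ON ANY PRESENTATION OF THE SPECIAL FIBRE.**  Over a LOCAL `R` with an `R`-point `x̃ : Spec R → T`
of the base of `𝒜`, a Serre presentation `(E′, P, Q, N)` of `𝔭` (★ (S-c)), `K` algebraically closed under `R` with `N ≠ 0` in `K`, `L` any field under `R`: if
`(G′, ι′, hker′)` is a dock on the presentation `(𝒜 ×_T U₁) ×_{U₁} x₁` of the special fibre (`h₁ : x₁ ≫ j₁ = Spec(algebraMap R L) ≫ x̃`) then on the presentation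
`(𝒜 ×_T U₂) ×_{U₂} x₂` of the geometric generic fibre (`h₂ : x₂ ≫ j₂ = Spec(algebraMap R K) ≫ x̃`) the `𝔭`-torsion `K`-points number `dim_L Γ(G′)` (§2 twice + ★ (GP)
`natCard_idealTorsion_algPoints_eq_finrank_of_iso_of_forall_iff` at `A := 𝒜 ×_T Spec R`). [cite: SerreTate1968, §1] [cite: Tate1997FiniteFlatGroupSchemes, (3.7)]
[cite: GortzWedhorn2020, Section (4.15) (p. 116)] -/
theorem natCard_idealTorsion_algPoints_eq_finrank_of_dock_of_comp_eq [IsLocalRing R] (hP : E' * P = P) (hQ : Q * E' = Q)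
    (hQP : Q * P = Matrix.scalar (Fin 1) (N : O)) (hPQ : P * Q = Matrix.scalar (Fin m) (N : O) * E')
    (K : Type u) [Field K] [IsAlgClosed K] [Algebra R K] (hN : (N : K) ≠ 0) (L : Type u) [Field L] [Algebra R L]
    {𝔭 : Ideal O} (h𝔭 : Ideal.span (Set.range fun k => P k 0) = 𝔭)
    (j₁ : U₁ ⟶ T) {x₁ : Spec (.of L) ⟶ U₁} (h₁ : x₁ ≫ j₁ = Spec.map (CommRingCat.ofHom (algebraMap R L)) ≫ xt)
    {G' : SchemeOver L} [IsAffine G'.left] [GrpObj G'] (ι' : G' ⟶ ((𝒜.baseChange j₁).baseChange x₁).X) [Mono ι'] [IsMonHom ι']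
    (hker' : ∀ ⦃W : SchemeOver L⦄ (t : W ⟶ ((𝒜.baseChange j₁).baseChange x₁).X),
      (∃ s : W ⟶ G', s ≫ ι' = t) ↔ ∀ a ∈ 𝔭, t ≫ ((ρ.baseChange j₁).baseChange x₁).i a = 1)
    (j₂ : U₂ ⟶ T) {x₂ : Spec (.of K) ⟶ U₂} (h₂ : x₂ ≫ j₂ = Spec.map (CommRingCat.ofHom (algebraMap R K)) ≫ xt) :
    Nat.card {t : AlgPoints ((𝒜.baseChange j₂).baseChange x₂).X K // ∀ a ∈ 𝔭, t ≫ ((ρ.baseChange j₂).baseChange x₂).i a = 1} =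
      Module.finrank L (Alg G') := by
  haveI : IsCommMonObj (𝒜.baseChange xt).X := isCommMonObj_baseChange xt
  -- special side: transport the dock to `(𝒜 ×_T Spec R) ×_R Spec L`
  obtain ⟨φ₁, hφ₁m, hφ₁⟩ := exists_equivariant_iso_baseChange_baseChange_of_comp_eq j₁ xt 𝒜 ρ h₁
  haveI := hφ₁m
  haveI : Mono (ι' ≫ φ₁.hom) := dockTransport_mono φ₁ ι'
  have hker'' := dockTransport_ker ((ρ.baseChange j₁).baseChange x₁) ((ρ.baseChange xt).baseChange _) φ₁ hφ₁ ι' hker'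
  -- generic side: the presentation `x₂` vs `(𝒜 ×_T Spec R) ×_R Spec K`
  obtain ⟨φ₂, hφ₂m, hφ₂⟩ := exists_equivariant_iso_baseChange_baseChange_of_comp_eq j₂ xt 𝒜 ρ h₂
  haveI := hφ₂m
  exact natCard_idealTorsion_algPoints_eq_finrank_of_iso_of_forall_iff (ρ.baseChange xt) E' hE' P Q hP hQ hQP hPQ K hN L h𝔭
    (ι' ≫ φ₁.hom) hker'' ((ρ.baseChange j₂).baseChange x₂) φ₂ hφ₂

include hE' in
/-- **`q + 1` LINES AT ANY PRESENTATION, FROM A DOCK OF RANK `q²` ON ANY PRESENTATION OF THE SPECIAL FIBRE** — the LS-leaflet head `natCard_lineOf_eq_succ` with the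
D-line tokens abstracted: under the hypotheses of `natCard_idealTorsion_algPoints_eq_finrank_of_dock_of_comp_eq` with `𝔭` maximal, `#(O ⧸ 𝔭) = q` finite and
`hrk : dim_L Γ(G′) = q²` (dock row `hrkG₀`), EXACTLY `q + 1` subgroups of `((𝒜 ×_T U₂) ×_{U₂} x₂)(K)` of order `q` consist of `𝔭`-torsion points and are stable under every
`ι(a)` (★ (GP) `natCard_stableSubgroups_eq_succ_of_iso_of_forall_iff`).  Feed (D-line): `𝒜 := I.univ`, `ρ := I.act`, `j₁ := ι_s`, `x₁ := x̄.left` with the dock `𝔡 x̄`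
(`hker′ := fun W t => ((𝔡 x̄).hkerG₀ t).symm`, `hrk := (𝔡 x̄).hrkG₀`), `j₂ := ι_η`, `x₂ := (ℓ_e y).left`, `x̃ := extendPoint …`, `h₁ h₂` := ★ (d5) §2, then `I.hfDeg`.
[cite: SerreTate1968, §1] [cite: Tate1997FiniteFlatGroupSchemes, (3.7)] [cite: GortzWedhorn2020, Section (4.15) (p. 116)] -/
theorem natCard_stableSubgroups_eq_succ_of_dock_of_comp_eq [IsLocalRing R] (hP : E' * P = P) (hQ : Q * E' = Q)
    (hQP : Q * P = Matrix.scalar (Fin 1) (N : O)) (hPQ : P * Q = Matrix.scalar (Fin m) (N : O) * E')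
    (K : Type u) [Field K] [IsAlgClosed K] [Algebra R K] (hN : (N : K) ≠ 0) (L : Type u) [Field L] [Algebra R L]
    {𝔭 : Ideal O} [𝔭.IsMaximal] [Finite (O ⧸ 𝔭)] (h𝔭 : Ideal.span (Set.range fun k => P k 0) = 𝔭)
    (j₁ : U₁ ⟶ T) {x₁ : Spec (.of L) ⟶ U₁} (h₁ : x₁ ≫ j₁ = Spec.map (CommRingCat.ofHom (algebraMap R L)) ≫ xt)
    {G' : SchemeOver L} [IsAffine G'.left] [GrpObj G'] (ι' : G' ⟶ ((𝒜.baseChange j₁).baseChange x₁).X) [Mono ι'] [IsMonHom ι']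
    (hker' : ∀ ⦃W : SchemeOver L⦄ (t : W ⟶ ((𝒜.baseChange j₁).baseChange x₁).X),
      (∃ s : W ⟶ G', s ≫ ι' = t) ↔ ∀ a ∈ 𝔭, t ≫ ((ρ.baseChange j₁).baseChange x₁).i a = 1)
    (hrk : Module.finrank L (Alg G') = Nat.card (O ⧸ 𝔭) ^ 2)
    (j₂ : U₂ ⟶ T) {x₂ : Spec (.of K) ⟶ U₂} (h₂ : x₂ ≫ j₂ = Spec.map (CommRingCat.ofHom (algebraMap R K)) ≫ xt) :
    Nat.card {H : Subgroup (AlgPoints ((𝒜.baseChange j₂).baseChange x₂).X K) // Nat.card H = Nat.card (O ⧸ 𝔭) ∧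
        (∀ t ∈ H, ∀ a ∈ 𝔭, t ≫ ((ρ.baseChange j₂).baseChange x₂).i a = 1) ∧
        ∀ a, ∀ t ∈ H, t ≫ ((ρ.baseChange j₂).baseChange x₂).i a ∈ H} = Nat.card (O ⧸ 𝔭) + 1 := by
  haveI : IsCommMonObj (𝒜.baseChange xt).X := isCommMonObj_baseChange xt
  obtain ⟨φ₁, hφ₁m, hφ₁⟩ := exists_equivariant_iso_baseChange_baseChange_of_comp_eq j₁ xt 𝒜 ρ h₁
  haveI := hφ₁m
  haveI : Mono (ι' ≫ φ₁.hom) := dockTransport_mono φ₁ ι'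
  have hker'' := dockTransport_ker ((ρ.baseChange j₁).baseChange x₁) ((ρ.baseChange xt).baseChange _) φ₁ hφ₁ ι' hker'
  obtain ⟨φ₂, hφ₂m, hφ₂⟩ := exists_equivariant_iso_baseChange_baseChange_of_comp_eq j₂ xt 𝒜 ρ h₂
  haveI := hφ₂m
  exact natCard_stableSubgroups_eq_succ_of_iso_of_forall_iff (ρ.baseChange xt) E' hE' P Q hP hQ hQP hPQ K hN L h𝔭
    (ι' ≫ φ₁.hom) hker'' hrk ((ρ.baseChange j₂).baseChange x₂) φ₂ hφ₂

include hE' in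
/-- **«ANOTHER LINE»** at any presentation (the SP-SURJ `htwo` ∕ L3 `hthree`-type feeds): under the hypotheses of `natCard_stableSubgroups_eq_succ_of_dock_of_comp_eq`,
every `H₀` has an admissible partner `H ≠ H₀`. [cite: Tate1997FiniteFlatGroupSchemes, (3.7)] -/
theorem exists_stableSubgroup_ne_of_dock_of_comp_eq [IsLocalRing R] (hP : E' * P = P) (hQ : Q * E' = Q)
    (hQP : Q * P = Matrix.scalar (Fin 1) (N : O)) (hPQ : P * Q = Matrix.scalar (Fin m) (N : O) * E')
    (K : Type u) [Field K] [IsAlgClosed K] [Algebra R K] (hN : (N : K) ≠ 0) (L : Type u) [Field L] [Algebra R L]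
    {𝔭 : Ideal O} [𝔭.IsMaximal] [Finite (O ⧸ 𝔭)] (h𝔭 : Ideal.span (Set.range fun k => P k 0) = 𝔭)
    (j₁ : U₁ ⟶ T) {x₁ : Spec (.of L) ⟶ U₁} (h₁ : x₁ ≫ j₁ = Spec.map (CommRingCat.ofHom (algebraMap R L)) ≫ xt)
    {G' : SchemeOver L} [IsAffine G'.left] [GrpObj G'] (ι' : G' ⟶ ((𝒜.baseChange j₁).baseChange x₁).X) [Mono ι'] [IsMonHom ι']
    (hker' : ∀ ⦃W : SchemeOver L⦄ (t : W ⟶ ((𝒜.baseChange j₁).baseChange x₁).X),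
      (∃ s : W ⟶ G', s ≫ ι' = t) ↔ ∀ a ∈ 𝔭, t ≫ ((ρ.baseChange j₁).baseChange x₁).i a = 1)
    (hrk : Module.finrank L (Alg G') = Nat.card (O ⧸ 𝔭) ^ 2)
    (j₂ : U₂ ⟶ T) {x₂ : Spec (.of K) ⟶ U₂} (h₂ : x₂ ≫ j₂ = Spec.map (CommRingCat.ofHom (algebraMap R K)) ≫ xt)
    (H₀ : Subgroup (AlgPoints ((𝒜.baseChange j₂).baseChange x₂).X K)) :
    ∃ H : Subgroup (AlgPoints ((𝒜.baseChange j₂).baseChange x₂).X K), (Nat.card H = Nat.card (O ⧸ 𝔭) ∧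
        (∀ t ∈ H, ∀ a ∈ 𝔭, t ≫ ((ρ.baseChange j₂).baseChange x₂).i a = 1) ∧
        ∀ a, ∀ t ∈ H, t ≫ ((ρ.baseChange j₂).baseChange x₂).i a ∈ H) ∧ H ≠ H₀ := by
  have h := natCard_stableSubgroups_eq_succ_of_dock_of_comp_eq 𝒜 ρ xt E' hE' P Q hP hQ hQP hPQ K hN L h𝔭 j₁ h₁ ι' hker' hrk j₂ h₂
  haveI : Finite {H : Subgroup (AlgPoints ((𝒜.baseChange j₂).baseChange x₂).X K) // Nat.card H = Nat.card (O ⧸ 𝔭) ∧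
      (∀ t ∈ H, ∀ a ∈ 𝔭, t ≫ ((ρ.baseChange j₂).baseChange x₂).i a = 1) ∧
      ∀ a, ∀ t ∈ H, t ≫ ((ρ.baseChange j₂).baseChange x₂).i a ∈ H} :=
    Nat.finite_of_card_ne_zero (by rw [h]; exact Nat.succ_ne_zero _)
  have h2 : 1 < Nat.card {H : Subgroup (AlgPoints ((𝒜.baseChange j₂).baseChange x₂).X K) // Nat.card H = Nat.card (O ⧸ 𝔭) ∧
      (∀ t ∈ H, ∀ a ∈ 𝔭, t ≫ ((ρ.baseChange j₂).baseChange x₂).i a = 1) ∧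
      ∀ a, ∀ t ∈ H, t ≫ ((ρ.baseChange j₂).baseChange x₂).i a ∈ H} := by
    rw [h]
    have : Nat.card (O ⧸ 𝔭) ≠ 0 := Nat.card_pos.ne'
    omega
  obtain ⟨H₁, H₂, hne⟩ := (Finite.one_lt_card_iff_nontrivial.1 h2).exists_pair_ne
  by_cases h₁' : H₁.1 = H₀
  · exact ⟨H₂.1, H₂.2, fun h₂' => hne (Subtype.ext (h₁'.trans h₂'.symm))⟩
  · exact ⟨H₁.1, H₁.2, h₁'⟩

end Assembly

end IdealTorsion

end AbelianSchemeOver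

end Literature.AlgebraicGeometry.AbelianSchemes

end
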